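import Summits.ResolutionOfSingularities.ResolutionOfSingularities.Theorems.UniformComplexityCampaignW82TwistExponentBaseChange
import Summits.ResolutionOfSingularities.ResolutionOfSingularities.Theorems.UniversalCellsCampaignW82KollarCurve
import Literature.AlgebraicGeometry.Resolution.ProjectiveSpaceRegular
import Mathlib.RingTheory.DiscreteValuationRing.TFAE
import Mathlib.RingTheory.Polynomial.Eisenstein.Basic
import Mathlib.FieldTheory.RatFunc.AsPolynomial
import HarnessLib

/-!
# [OURS · L1 W8.2] The curve `y^q = x^P − t` is REGULAR; `X^n − t` is irreducible over `M(t)` (algebra for the regular rung)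

Cell `res-hironaka` (run/shared/lean/pub/res-hironaka/), LADDER-RESOLUTION rung L (RESCUE), slot W8.2 of
plan/RESCUE-SEED.md («PRIME-FIELD / UNIVERSALITY TRANSFER instead of descent»), door 2 = route
`UniformComplexity`, host item `PrimeModelTransfer` (stmt-ResolutionOfSingularities-8933); prover
res-L1-s82-pv-2 (gen 4). THESES-FREE algebra module (imports the gen-3 siblings `…TwistExponentBaseChange`
(`twistPoly`, `TwistRing`, `QIdeal`, `QIdeal_one_eq_span`, `prime_twistPoly'`, `twistCurve`), res-L1-s82-pv-1's
`…KollarCurve` (only the derivation lemma `derivation_apply_mem_of_mem_sq` and, through it, the barrier file's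
transport lemma `isRegularLocalRing_localization_map_mk`), the Literature file `Resolution.ProjectiveSpaceRegular`
(`Scheme.isRegular_Spec`), Mathlib, `HarnessLib`). Consumed by the sibling
Theorems/UniformComplexityCampaignW82TwistExponentRegular.lean (the REGULAR v2 of the gen-3 negative rung «no bounded
Frobenius-twist exponent»).

[OURS · L1 W8.2] support lemmas; replace the role of no printed item; NOT statements of H. Hironaka's manuscript.
For any field `K`, `P ≥ 1`, a prime `q` with `q ∤ P` and `q ≠ 0` in `K`, and `X^P − t` irreducible over `K`:

* §13 `irreducible_X_pow_sub_C_polynomialX` / `irreducible_X_pow_sub_C_ratFuncX_of_pos`: `X^n − t` is irreducible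
  in `M[t][X]` (Eisenstein at the prime `(t)`, Mathlib `Polynomial.IsEisensteinAt.irreducible`) and over
  `M(t)` (Gauss, Mathlib `Monic.irreducible_iff_irreducible_map_fraction_map`), every `n ≥ 1`, every field `M`
  — needed with `n = p^m` in every characteristic including `p = 2` (Mathlib's Kummer criterion
  `X_pow_sub_C_irreducible_of_prime_pow` excludes `p = 2`);
* §14 `isRegularRing_twistRing_one`: `A_1 = K[X₀,X₁]/(X₀^q − X₁^P + t)` is a REGULAR ring — at the inseparable
  point `Q_1 = (y)` (`QIdeal_one_eq_span`, «the maximal ideal … is generated by `y` alone», Kollár 1.19) it is a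
  Noetherian local domain with principal maximal ideal, hence a principal ideal ring (Mathlib's DVR
  `tfae_of_isNoetherianRing_of_isLocalRing_of_isDomain`) and regular (`isRegularLocalRing_localization_QIdeal_one`);
  a prime containing `y` IS that point (`eq_QIdeal_one_of_yElt_mem`); at every other prime
  `∂f/∂X₀ = qX₀^{q−1} ∉ 𝔮` forces `f ∉ 𝔪_𝔮²` (`twistPoly_one_not_mem_sq`: a derivation maps `𝔮²` into `𝔮`) and
  `K[X₀,X₁]_𝔮/(f)` is regular by Matsumura 14.2 (tree `IsRegularLocalRing.quotient_span_singleton`). The template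
  is res-L1-s82-pv-1's `KollarCurveAnyField.isRegularRing_kollarRing` (the case `P = p`, other coordinate ring),
  credited; `isRegular_twistCurve_one` (`Scheme.IsRegular`), `isIntegral_twistCurve_one`.

HONEST FRAMING. OURS support; mathematics = Kollár 2007, 1.19 / Liu 2002, Ex. 7.3.15 / Matsumura 14.2; nothing here
is a statement of H. Hironaka's manuscript [Hironaka2017], nothing attributed to its author. No `sorry`, no new
axioms. AI work, weaker than expert review.

## References (locators only)
* J. Kollár, *Lectures on Resolution of Singularities* (2007), 1.19. [Kollar2007]
* Q. Liu, *Algebraic Geometry and Arithmetic Curves* (2002), Ex. 7.3.15. [Liu2002]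
* H. Matsumura, *Commutative Ring Theory* (1986), Thm. 14.2. [Matsumura1987]
-/

noncomputable section

set_option linter.dupNamespace false -- mandated namespace of this single-conjunct summit

open Polynomial IsLocalRing
open _root_.CategoryTheory _root_.CategoryTheory.Limits _root_.AlgebraicGeometry
open Summit.ResolutionOfSingularities.ResolutionOfSingularities.Theorems.CampaignW82.KollarCurve
  (derivation_apply_mem_of_mem_sq)

namespace Summit.ResolutionOfSingularities.ResolutionOfSingularities.Theorems.CampaignW82.TwistExponent

open Literature.AlgebraicGeometry.Resolution

/-! ## §13 `X^n − t` is irreducible over `M(t)` for every `n ≥ 1` (Eisenstein at `t`, Gauss) -/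

section Eisenstein

/-- **`X^n − t ∈ M[t][X]` is irreducible for `n ≥ 1`**: Eisenstein at the prime `(t)` of `M[t]`. [folklore] -/
theorem irreducible_X_pow_sub_C_polynomialX (M : Type) [Field M] {n : ℕ} (hn : 0 < n) :
    Irreducible (X ^ n - C (Polynomial.X : M[X]) : M[X][X]) := by
  have hmonic : (X ^ n - C (Polynomial.X : M[X]) : M[X][X]).Monic := monic_X_pow_sub_C _ hn.ne'
  have hdeg : (X ^ n - C (Polynomial.X : M[X]) : M[X][X]).natDegree = n := natDegree_X_pow_sub_C
  let 𝓟 : Ideal M[X] := Ideal.span {Polynomial.X}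
  have h𝓟 : 𝓟.IsPrime := by
    rw [Ideal.span_singleton_prime Polynomial.X_ne_zero]; exact Polynomial.prime_X
  have heis : (X ^ n - C (Polynomial.X : M[X]) : M[X][X]).IsEisensteinAt 𝓟 := by
    refine hmonic.isEisensteinAt_of_mem_of_notMem h𝓟.ne_top ?_ ?_
    · intro k hk
      rw [hdeg] at hk
      rw [coeff_sub, coeff_X_pow, if_neg hk.ne, coeff_C, zero_sub]
      split_ifs with h0
      · exact 𝓟.neg_mem (Ideal.subset_span (Set.mem_singleton _))
      · rw [neg_zero]; exact Ideal.zero_mem _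
    · rw [coeff_sub, coeff_X_pow, if_neg hn.ne, coeff_C, if_pos rfl, zero_sub, neg_mem_iff,
        Ideal.span_singleton_pow, Ideal.mem_span_singleton]
      intro h
      have h1 : (Polynomial.X : M[X]) ^ 2 ∣ Polynomial.X ^ 1 := by rwa [pow_one]
      rw [pow_dvd_pow_iff Polynomial.X_ne_zero Polynomial.not_isUnit_X] at h1
      omega
  exact heis.irreducible h𝓟 hmonic.isPrimitive (by rw [hdeg]; exact hn)

/-- **`X^n − t` is irreducible over `K = M(t)` for every `n ≥ 1`** (Gauss's lemma over `M[t]`; the case `n = p`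
is `irreducible_X_pow_sub_C_ratFuncX`). [folklore] -/
theorem irreducible_X_pow_sub_C_ratFuncX_of_pos (M : Type) [Field M] {n : ℕ} (hn : 0 < n) :
    Irreducible (X ^ n - C (RatFunc.X : RatFunc M)) := by
  have hmonic : (X ^ n - C (Polynomial.X : M[X]) : M[X][X]).Monic := monic_X_pow_sub_C _ hn.ne'
  have h := (hmonic.irreducible_iff_irreducible_map_fraction_map (K := RatFunc M)).mp
    (irreducible_X_pow_sub_C_polynomialX M hn)
  simpa [Polynomial.map_sub, Polynomial.map_pow, map_X, map_C, RatFunc.algebraMap_X] using h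

end Eisenstein

/-! ## §14 Regularity of `A_1 = K[X₀,X₁]/(X₀^q − X₁^P + t)` at every prime -/

section Regularity

variable (K : Type) [Field K] (P : ℕ) (t : K) (q : ℕ) [hq : Fact q.Prime]

omit hq in
/-- `∂f_1/∂X₀ = q X₀^{q−1}`. [folklore] -/
theorem pderiv_zero_twistPoly_one :
    MvPolynomial.pderiv 0 (twistPoly K P t q 1) =
      (q : MvPolynomial (Fin 2) K) * MvPolynomial.X 0 ^ (q - 1) := by
  have h10 : (1 : Fin 2) ≠ 0 := by decide
  simp only [twistPoly, pow_one, map_sub, Derivation.leibniz_pow, MvPolynomial.pderiv_X_self,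
    MvPolynomial.pderiv_X_of_ne h10, MvPolynomial.pderiv_C, smul_eq_mul, mul_one, nsmul_eq_mul, mul_zero,
    sub_zero]

variable {K P t q} in
omit hq in
/-- At a prime `Q ∌ X₀` of `K[X₀,X₁]` containing `f_1 = X₀^q − X₁^P + t` (`q ≠ 0` in `K`), `f_1 ∉ 𝔪_Q²`:
otherwise `∂f_1/∂X₀ = q X₀^{q−1} ∈ Q` (a derivation maps `Q²` into `Q`). [folklore] -/
theorem twistPoly_one_not_mem_sq (hqK : (q : K) ≠ 0) (Q : Ideal (MvPolynomial (Fin 2) K)) [Q.IsPrime]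
    (hY : MvPolynomial.X 0 ∉ Q) :
    algebraMap _ (Localization.AtPrime Q) (twistPoly K P t q 1) ∉ (maximalIdeal _) ^ 2 := by
  intro h
  rw [← Localization.AtPrime.map_eq_maximalIdeal, ← Ideal.map_pow,
    IsLocalization.mem_map_algebraMap_iff Q.primeCompl] at h
  obtain ⟨⟨⟨i, hi⟩, ⟨s, hs⟩⟩, h⟩ := h
  simp only at h
  rw [← map_mul] at h
  have hinj : Function.Injective (algebraMap (MvPolynomial (Fin 2) K) (Localization.AtPrime Q)) :=
    IsLocalization.injective _ Q.primeCompl_le_nonZeroDivisors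
  have hmem : twistPoly K P t q 1 * s ∈ Q ^ 2 := by rw [hinj h]; exact hi
  -- apply `∂/∂X₀`
  have hD := derivation_apply_mem_of_mem_sq (MvPolynomial.pderiv 0) Q hmem
  have hfQ : twistPoly K P t q 1 ∈ Q :=
    (Ideal.IsPrime.mem_or_mem ‹_› (Ideal.pow_le_self two_ne_zero hmem)).resolve_right hs
  rw [Derivation.leibniz, smul_eq_mul, smul_eq_mul] at hD
  have h2 : s * MvPolynomial.pderiv 0 (twistPoly K P t q 1) ∈ Q := by
    have h3 : twistPoly K P t q 1 * MvPolynomial.pderiv 0 s ∈ Q := Q.mul_mem_right _ hfQ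
    simpa using (Submodule.sub_mem _ hD h3)
  have h4 : MvPolynomial.pderiv 0 (twistPoly K P t q 1) ∈ Q :=
    (Ideal.IsPrime.mem_or_mem ‹_› h2).resolve_left hs
  rw [pderiv_zero_twistPoly_one] at h4
  have hunit : IsUnit (q : MvPolynomial (Fin 2) K) := by
    rw [← map_natCast (MvPolynomial.C (σ := Fin 2) (R := K)) q]
    exact (isUnit_iff_ne_zero.mpr hqK).map _
  rw [Ideal.unit_mul_mem_iff_mem _ hunit] at h4
  exact hY (Ideal.IsPrime.mem_of_pow_mem ‹_› _ h4)

/-- **A prime of `A_1` containing `y` is the point `Q_1`** (`Q_1 = (y)` is maximal for `X^P − t` irreducible).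
[folklore] -/
theorem eq_QIdeal_one_of_yElt_mem (ht : Irreducible (X ^ P - C t : K[X])) (Q : Ideal (TwistRing K P t q 1))
    [hQ : Q.IsPrime] (hy : yElt K P t q 1 ∈ Q) : Q = QIdeal K P t q 1 := by
  have hle : QIdeal K P t q 1 ≤ Q := by
    rw [QIdeal_one_eq_span, Ideal.span_le, Set.singleton_subset_iff]; exact hy
  exact ((QIdeal_isMaximal K P t q ht Nat.one_pos).eq_of_le hQ.ne_top hle).symm

/-- **`(A_1)_{Q_1}` is a regular local ring**: a Noetherian local domain whose maximal ideal `(y)` is principal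
(`QIdeal_one_eq_span`) is a principal ideal ring (Mathlib's DVR `TFAE`), hence regular. [folklore] -/
theorem isRegularLocalRing_localization_QIdeal_one (hP : 0 < P) (hqP : ¬ q ∣ P)
    (ht : Irreducible (X ^ P - C t : K[X])) :
    haveI := QIdeal_isPrime K P t q ht Nat.one_pos
    IsRegularLocalRing (Localization.AtPrime (QIdeal K P t q 1)) := by
  haveI hQ := QIdeal_isPrime K P t q ht Nat.one_pos
  have hq1 : ¬ q ∣ 1 := fun h => hq.out.ne_one (Nat.dvd_one.mp h)
  haveI : IsDomain (TwistRing K P t q 1) := isDomain_twistRing' hP hqP hq1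
  have hmap : Ideal.map (algebraMap (TwistRing K P t q 1) (Localization.AtPrime (QIdeal K P t q 1)))
      (QIdeal K P t q 1) =
      Ideal.span {algebraMap _ (Localization.AtPrime (QIdeal K P t q 1)) (yElt K P t q 1)} := by
    have h := congrArg
      (Ideal.map (algebraMap (TwistRing K P t q 1) (Localization.AtPrime (QIdeal K P t q 1))))
      (QIdeal_one_eq_span K P t q)
    rw [h, Ideal.map_span, Set.image_singleton]
  have hprinc : (maximalIdeal (Localization.AtPrime (QIdeal K P t q 1))).IsPrincipal := by
    rw [← Localization.AtPrime.map_eq_maximalIdeal, hmap]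
    exact ⟨⟨_, rfl⟩⟩
  haveI : IsPrincipalIdealRing (Localization.AtPrime (QIdeal K P t q 1)) :=
    ((tfae_of_isNoetherianRing_of_isLocalRing_of_isDomain
      (Localization.AtPrime (QIdeal K P t q 1))).out 4 0).mp hprinc
  infer_instance

/-- **`A_1 = K[X₀,X₁]/(X₀^q − X₁^P + t)` is a REGULAR ring** (`P ≥ 1`, `q` a prime with `q ∤ P` and `q ≠ 0` in
`K`, `X^P − t` irreducible over `K`): at the point `Q_1 = (y)` by `isRegularLocalRing_localization_QIdeal_one`;
at every other prime `y` is a unit direction, `f_1 ∉ 𝔪²` (`twistPoly_one_not_mem_sq`) and `K[X₀,X₁]_𝔮/(f_1)` is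
regular by Matsumura 14.2 (tree `IsRegularLocalRing.quotient_span_singleton`), transported to `(A_1)_{𝔮/(f_1)}` by
the barrier file's `isRegularLocalRing_localization_map_mk`. (Template: res-L1-s82-pv-1's
`KollarCurveAnyField.isRegularRing_kollarRing`, the case `P = p`.) [folklore] -/
theorem isRegularRing_twistRing_one (hP : 0 < P) (hqP : ¬ q ∣ P) (hqK : (q : K) ≠ 0)
    (ht : Irreducible (X ^ P - C t : K[X])) : IsRegularRing (TwistRing K P t q 1) := by
  rw [isRegularRing_iff]
  intro Q hQ
  by_cases hY : yElt K P t q 1 ∈ Q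
  · obtain rfl := eq_QIdeal_one_of_yElt_mem K P t q ht Q hY
    exact isRegularLocalRing_localization_QIdeal_one K P t q hP hqP ht
  · -- `Q = Q₀/(f)` with `X₀ ∉ Q₀`
    set Q₀ := Q.comap (Ideal.Quotient.mk (Ideal.span {twistPoly K P t q 1})) with hQ₀
    have hY₀ : MvPolynomial.X 0 ∉ Q₀ := hY
    have hfQ₀ : Ideal.span {twistPoly K P t q 1} ≤ Q₀ := by
      rw [hQ₀, ← Ideal.map_le_iff_le_comap, Ideal.map_quotient_self]
      exact bot_le
    have hQeq : Q₀.map (Ideal.Quotient.mk (Ideal.span {twistPoly K P t q 1})) = Q :=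
      Ideal.map_comap_of_surjective _ Ideal.Quotient.mk_surjective Q
    have key : IsRegularLocalRing (Localization.AtPrime Q₀ ⧸
        (Ideal.span {twistPoly K P t q 1}).map (algebraMap _ (Localization.AtPrime Q₀))) := by
      rw [Ideal.map_span, Set.image_singleton]
      have hmem : algebraMap _ (Localization.AtPrime Q₀) (twistPoly K P t q 1) ∈ maximalIdeal _ := by
        rw [← Localization.AtPrime.map_eq_maximalIdeal]
        exact Ideal.mem_map_of_mem _ (hfQ₀ (Ideal.subset_span rfl))
      exact (IsRegularLocalRing.quotient_span_singleton hmem (twistPoly_one_not_mem_sq hqK Q₀ hY₀)).1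
    haveI : (Q₀.map (Ideal.Quotient.mk (Ideal.span {twistPoly K P t q 1}))).IsPrime := by rw [hQeq]; exact hQ
    have h := Literature.Barriers.ResolutionOfSingularities.isRegularLocalRing_localization_map_mk
      (Ideal.span {twistPoly K P t q 1}) Q₀ hfQ₀ key
    -- transport along the equality of primes `Q₀/(f) = Q`
    have hS : (Q₀.map (Ideal.Quotient.mk (Ideal.span {twistPoly K P t q 1}))).primeCompl = Q.primeCompl := by
      ext x; simp [Ideal.primeCompl, hQeq]
    haveI : IsLocalization.AtPrime
        (Localization.AtPrime (Q₀.map (Ideal.Quotient.mk (Ideal.span {twistPoly K P t q 1})))) Q := by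
      change IsLocalization Q.primeCompl _
      rw [← hS]
      infer_instance
    exact IsRegularLocalRing.of_ringEquiv
      (R := Localization.AtPrime (Q₀.map (Ideal.Quotient.mk (Ideal.span {twistPoly K P t q 1}))))
      (IsLocalization.algEquiv Q.primeCompl
        (Localization.AtPrime (Q₀.map (Ideal.Quotient.mk (Ideal.span {twistPoly K P t q 1}))))
        (Localization.AtPrime Q)).toRingEquiv

/-- **The curve `C_1 : y^q = x^P − t` is a REGULAR scheme** (hypotheses of `isRegularRing_twistRing_one`).
[folklore] -/
theorem isRegular_twistCurve_one (hP : 0 < P) (hqP : ¬ q ∣ P) (hqK : (q : K) ≠ 0)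
    (ht : Irreducible (X ^ P - C t : K[X])) : Scheme.IsRegular (twistCurve K P t q 1) :=
  haveI := isRegularRing_twistRing_one K P t q hP hqP hqK ht
  Scheme.isRegular_Spec _

/-- **`C_1` is an integral scheme** (`P ≥ 1`, `q ∤ P`). [folklore] -/
theorem isIntegral_twistCurve_one (hP : 0 < P) (hqP : ¬ q ∣ P) : IsIntegral (twistCurve K P t q 1) :=
  haveI : IsDomain (TwistRing K P t q 1) :=
    isDomain_twistRing' hP hqP (fun h => hq.out.ne_one (Nat.dvd_one.mp h))
  inferInstance

end Regularity

end Summit.ResolutionOfSingularities.ResolutionOfSingularities.Theorems.CampaignW82.TwistExponent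

end
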